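import Literature.Topology.FourManifolds.GaussDiagramsPerturbation
import Literature.Topology.FourManifolds.GaussDiagramsGenericity
import Mathlib.Analysis.Calculus.InverseFunctionTheorem.FDeriv
import Mathlib.Data.Finset.Sort
import HarnessLib

/-!
# Reading off the Gauss diagram of a knot in general position

Topic `Literature/Topology/FourManifolds`; fourth brick of the proof of the named fact
`Literature.Topology.FourManifolds.Knot.exists_hasGaussDiagram_of_isIsotopic` (`GaussDiagrams.lean`;
Reidemeister, *Knotentheorie* (1932), Kap. I §1; Cromwell, *Knots and Links* (2004), Thm. 3.2.1
and Def. 3.3.1). Everything here is proved; no named facts.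

* `Literature.Topology.FourManifolds.Knot.InGeneralPosition K` — the analytic output of the
  perturbation argument: `K` misses the north pole, its stereographic plane curve
  `γ = K.planeCurve` is an immersion, at every double point `γ s = γ t` (`s ≢ t mod 2π`) the two
  velocities are linearly independent, and there are no triple points.
* `Literature.Topology.FourManifolds.Knot.InGeneralPosition.hasGaussDiagram` — **such a knot has
  a Gauss diagram**, i.e. admits a `Knot.RegularProjection` (`GaussDiagrams.lean`). Construction
  (Cromwell (2004), §3.2–3.3; Goussarov–Polyak–Viro (2000), §1.2): the set of crossing
  parameters in the period window `[0, 2π)` is **finite** (`finite_crossingSet`: the double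
  points `(s, t)` at distance `≥ δ` from the diagonal modulo `2π` form a compact set — `δ` from the
  local injectivity modulus of the immersed curve, `exists_local_modulus` — each of whose points
  is isolated by the inverse function theorem at a transverse double point,
  `exists_nhds_injOn_of_cross_ne_zero`, so an accumulation point is impossible); each crossing
  parameter has a unique **partner** (no triple points), a fixed-point free involution of the
  crossing set whose two ends have different heights (the space curve is injective); the
  over-ends `O` and the under-ends `U` are exchanged by the partner map, so `|T| = 2n`; the
  positions are numbered increasingly by `Finset.orderEmbOfFin`, the chords by an enumeration of
  `O`, the signs are the signs of `det (γ' over, γ' under)` (nonzero by transversality), and all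
  axioms of `Knot.RegularProjection` are checked.

## References

* P. R. Cromwell, *Knots and Links*, CUP (2004), §3.2 (Thm. 3.2.1, regular projections), §3.3
  (Def. 3.3.1, diagrams). [Cromwell2004]
* M. Goussarov, M. Polyak, O. Viro, *Finite-type invariants of classical and virtual knots*,
  Topology 39 (2000), §1.2 (Gauss diagrams). [GPV2000]
* K. Reidemeister, *Knotentheorie* (1932), Kap. I §1. [Reidemeister1932]

## Design notes

`InGeneralPosition` is a `Prop`-valued structure (a predicate on knots, like
`IsRegularClosedCurve`), not a named fact. The partner map and the enumerations are
noncomputable definitions taking the proof `h : K.InGeneralPosition` as an argument. No statement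
of another file is modified; no `sorry`; `𝔼 n`, `𝕊 n` are local notation as in `Knots.lean`.
-/

open scoped Manifold ContDiff Topology
open Function Set Filter

noncomputable section

namespace Literature.Topology.FourManifolds

/-- Local notation: `𝔼 n` is the model Euclidean space `EuclideanSpace ℝ (Fin n)`. -/
local notation "𝔼 " n:arg => EuclideanSpace ℝ (Fin n)

/-- Local notation: `𝕊 n` is the unit sphere in `EuclideanSpace ℝ (Fin (n + 1))`. -/
local notation "𝕊 " n:arg => (Metric.sphere (0 : EuclideanSpace ℝ (Fin (n + 1))) 1)

attribute [local instance] fact_finrank_euclideanSpace_two fact_finrank_euclideanSpace_four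

/-! ### Angles in the period window -/

/-- `circlePoint` is injective on the period window `[0, 2π)`. [folklore] -/
theorem eq_of_circlePoint_eq_of_mem_Ico {s t : ℝ} (hs : s ∈ Ico 0 (2 * Real.pi))
    (ht : t ∈ Ico 0 (2 * Real.pi)) (h : circlePoint s = circlePoint t) : s = t := by
  obtain ⟨k, hk⟩ := exists_eq_add_of_circlePoint_eq h
  have h2 : (0 : ℝ) < 2 * Real.pi := by positivity
  have hk1 : (k : ℝ) < 1 := by
    by_contra hge; push Not at hge
    have : t + 1 * (2 * Real.pi) ≤ t + k * (2 * Real.pi) := by gcongr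
    linarith [hs.2, ht.1]
  have hk2 : (-1 : ℝ) < k := by
    by_contra hle; push Not at hle
    have : t + k * (2 * Real.pi) ≤ t + (-1) * (2 * Real.pi) := by gcongr
    linarith [hs.1, ht.2]
  have hk0 : k = 0 := by
    have h1 : k < 1 := by exact_mod_cast hk1
    have h2 : -1 < k := by exact_mod_cast hk2
    omega
  rw [hk, hk0]; simp

/-- Every real has a translate by an integer multiple of `2π` in the period window, with the same
point on the circle. [folklore] -/
theorem exists_mem_Ico_circlePoint_eq (t : ℝ) :
    ∃ t' ∈ Ico 0 (2 * Real.pi), circlePoint t' = circlePoint t ∧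
      ∃ k : ℤ, t' = t + k * (2 * Real.pi) := by
  obtain ⟨k, hk⟩ := exists_int_sub_mul_two_pi_mem_Ico t
  refine ⟨t - k * (2 * Real.pi), hk, ?_, -k, by push_cast; ring⟩
  have := (periodic_circlePoint.int_mul (-k)) t
  rw [← this]; congr 1; push_cast; ring

/-! ### Linear dependence and the determinant -/

/-- A nontrivial relation `a • u₁ = b • u₂` forces `cross u₁ u₂ = 0`. [folklore] -/
theorem cross_eq_zero_of_smul_eq_smul {u₁ u₂ : ℝ × ℝ} {a b : ℝ} (hab : (a, b) ≠ (0, 0))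
    (h : a • u₁ = b • u₂) : cross u₁ u₂ = 0 := by
  have h1 : a * u₁.1 = b * u₂.1 := by simpa using congrArg Prod.fst h
  have h2 : a * u₁.2 = b * u₂.2 := by simpa using congrArg Prod.snd h
  unfold cross
  by_cases ha : a = 0
  · subst ha
    have hb : b ≠ 0 := fun hb ↦ hab (by rw [hb])
    simp only [zero_mul] at h1 h2
    have e1 : u₂.1 = 0 := (mul_eq_zero.1 h1.symm).resolve_left hb
    have e2 : u₂.2 = 0 := (mul_eq_zero.1 h2.symm).resolve_left hb
    rw [e1, e2]; ring
  · have : a * (u₁.1 * u₂.2 - u₁.2 * u₂.1) = 0 := by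
      linear_combination u₂.2 * h1 - u₂.1 * h2
    exact (mul_eq_zero.1 this).resolve_left ha

/-! ### Local injectivity at a transverse double point (inverse function theorem) -/

section Transverse

variable {γ : ℝ → ℝ × ℝ}

/-- The differential of `(s, t) ↦ γ s - γ t` at `p`: `(a, b) ↦ a • γ' p.1 - b • γ' p.2`, as a
continuous linear map. [folklore] -/
def doubleDiff (γ : ℝ → ℝ × ℝ) (p : ℝ × ℝ) : ℝ × ℝ →L[ℝ] ℝ × ℝ :=
  ((1 : ℝ →L[ℝ] ℝ).smulRight (deriv γ p.1)).comp (ContinuousLinearMap.fst ℝ ℝ ℝ) -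
    ((1 : ℝ →L[ℝ] ℝ).smulRight (deriv γ p.2)).comp (ContinuousLinearMap.snd ℝ ℝ ℝ)

/-- Evaluation of `doubleDiff`. [folklore] -/
@[simp] theorem doubleDiff_apply (p z : ℝ × ℝ) :
    doubleDiff γ p z = z.1 • deriv γ p.1 - z.2 • deriv γ p.2 := by
  simp [doubleDiff]

/-- `(s, t) ↦ γ s - γ t` has strict derivative `doubleDiff γ p` at `p`. [folklore] -/
theorem hasStrictFDerivAt_doubleDiff (hγ : ContDiff ℝ ∞ γ) (p : ℝ × ℝ) :
    HasStrictFDerivAt (fun q : ℝ × ℝ ↦ γ q.1 - γ q.2) (doubleDiff γ p) p := by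
  have hd : ∀ x, HasStrictFDerivAt γ ((1 : ℝ →L[ℝ] ℝ).smulRight (deriv γ x)) x := fun x ↦ by
    have h1 : HasStrictDerivAt γ (deriv γ x) x :=
      hγ.contDiffAt.hasStrictDerivAt (by simp)
    exact h1.hasStrictFDerivAt
  exact ((hd p.1).comp p hasStrictFDerivAt_fst).sub ((hd p.2).comp p hasStrictFDerivAt_snd)

/-- At a transverse double point `doubleDiff` is injective. [folklore] -/
theorem doubleDiff_injective {p : ℝ × ℝ} (hc : cross (deriv γ p.1) (deriv γ p.2) ≠ 0) :
    Injective (doubleDiff γ p) := by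
  intro z z' hzz'
  by_contra hne
  have h0 : doubleDiff γ p (z - z') = 0 := by rw [map_sub, hzz', sub_self]
  rw [doubleDiff_apply, sub_eq_zero] at h0
  refine hc (cross_eq_zero_of_smul_eq_smul (a := (z - z').1) (b := (z - z').2) ?_ h0)
  intro hab
  simp only [Prod.mk.injEq] at hab
  exact hne (sub_eq_zero.1 (Prod.ext hab.1 hab.2))

/-- **Local injectivity at a transverse double point.** If `cross (γ' s) (γ' t) ≠ 0` then
`(s', t') ↦ γ s' - γ t'` is injective on a neighbourhood of `(s, t)` (inverse function theorem).
[folklore] -/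
theorem exists_nhds_injOn_of_cross_ne_zero (hγ : ContDiff ℝ ∞ γ) {p : ℝ × ℝ}
    (hc : cross (deriv γ p.1) (deriv γ p.2) ≠ 0) :
    ∃ U ∈ 𝓝 p, InjOn (fun q : ℝ × ℝ ↦ γ q.1 - γ q.2) U := by
  have hinj := doubleDiff_injective hc
  have hker : LinearMap.ker (doubleDiff γ p : ℝ × ℝ →ₗ[ℝ] ℝ × ℝ) = ⊥ :=
    LinearMap.ker_eq_bot.2 hinj
  have hrange : LinearMap.range (doubleDiff γ p : ℝ × ℝ →ₗ[ℝ] ℝ × ℝ) = ⊤ :=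
    LinearMap.range_eq_top.2 (LinearMap.injective_iff_surjective.1 hinj)
  set e : (ℝ × ℝ) ≃L[ℝ] (ℝ × ℝ) := ContinuousLinearEquiv.ofBijective (doubleDiff γ p) hker hrange
    with he
  have hstrict : HasStrictFDerivAt (fun q : ℝ × ℝ ↦ γ q.1 - γ q.2) (e : ℝ × ℝ →L[ℝ] ℝ × ℝ) p := by
    rw [he, ContinuousLinearEquiv.coe_ofBijective]
    exact hasStrictFDerivAt_doubleDiff hγ p
  refine ⟨{q | hstrict.localInverse _ _ _ (γ q.1 - γ q.2) = q}, hstrict.eventually_left_inverse,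
    fun x hx y hy hxy ↦ ?_⟩
  have hx' : hstrict.localInverse _ _ _ (γ x.1 - γ x.2) = x := hx
  have hy' : hstrict.localInverse _ _ _ (γ y.1 - γ y.2) = y := hy
  rw [← hx', ← hy']
  exact congrArg _ hxy

end Transverse

/-! ### Knots in general position -/

namespace Knot

/-- A knot is **in general position** (with respect to the stereographic projection of
`GaussDiagrams.lean`) if it misses the north pole, its plane curve is an immersion, at every
double point `γ s = γ t` with `s ≢ t (mod 2π)` the velocities are linearly independent
(transverse crossing), and no three parameters pairwise distinct modulo `2π` have the same
projection (no triple points). Cromwell (2004), §3.2; Crowell–Fox, Ch. I §3 (regular position).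
[cite: Cromwell2004, §3.2] -/
structure InGeneralPosition (K : Knot) : Prop where
  /-- The knot misses the centre of projection. -/
  ne_northPole : ∀ x, K x ≠ northPole
  /-- The plane curve is an immersion. -/
  deriv_ne_zero : ∀ t, deriv K.planeCurve t ≠ 0
  /-- Double points are transverse. -/
  transverse : ∀ s t, K.planeCurve s = K.planeCurve t →
    circlePoint s = circlePoint t ∨ cross (deriv K.planeCurve s) (deriv K.planeCurve t) ≠ 0
  /-- There are no triple points. -/
  no_triple : ∀ s t u, K.planeCurve s = K.planeCurve u → K.planeCurve t = K.planeCurve u →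
    circlePoint s = circlePoint t ∨ circlePoint t = circlePoint u ∨ circlePoint s = circlePoint u

/-- The **crossing set**: parameters in the period window `[0, 2π)` whose projection is a double
point. [folklore] -/
def crossingSet (K : Knot) : Set ℝ :=
  {s | s ∈ Ico 0 (2 * Real.pi) ∧ ∃ t, circlePoint t ≠ circlePoint s ∧ K.planeCurve s = K.planeCurve t}

namespace InGeneralPosition

variable {K : Knot} (h : K.InGeneralPosition)
include h

/-- The plane curve is `C^∞`. [folklore] -/
theorem contDiff_planeCurve : ContDiff ℝ ∞ K.planeCurve := Knot.contDiff_planeCurve h.ne_northPole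

/-- Parameters with the same projection and the same height have the same point on the circle
(the knot is injective). [folklore] -/
theorem circlePoint_eq_of_planeCurve_eq_of_heightCurve_eq {s t : ℝ}
    (h1 : K.planeCurve s = K.planeCurve t) (h2 : K.heightCurve s = K.heightCurve t) :
    circlePoint s = circlePoint t :=
  (stereoCurve_eq_iff h.ne_northPole).1 (Prod.ext h1 h2)

/-- **The crossing set is finite.** [folklore] -/
theorem finite_crossingSet : (crossingSet K).Finite := by
  have hγs : ContDiff ℝ ∞ K.planeCurve := h.contDiff_planeCurve
  -- the local injectivity modulus of the immersed plane curve
  obtain ⟨m, hm, δ, hδ, -, hmod⟩ := exists_local_modulus (hγs.of_le (by exact_mod_cast le_top))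
    K.periodic_planeCurve h.deriv_ne_zero
  have hnear : ∀ s t, |s - t| ≤ δ → K.planeCurve s = K.planeCurve t → s = t := by
    intro s t hst hγst
    have := hmod s t hst
    rw [hγst, sub_self, norm_zero] at this
    have : |s - t| = 0 := le_antisymm (by nlinarith [abs_nonneg (s - t)]) (abs_nonneg _)
    linarith [abs_eq_zero.1 this]
  -- the compact set of far double points in the period square
  set D : Set (ℝ × ℝ) := ((Icc (0 : ℝ) (2 * Real.pi) ×ˢ Icc (0 : ℝ) (2 * Real.pi)) ∩
    {p | K.planeCurve p.1 = K.planeCurve p.2}) ∩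
      ⋂ k : ℤ, {p : ℝ × ℝ | δ ≤ |p.1 - p.2 - k * (2 * Real.pi)|} with hD
  have hγc : Continuous K.planeCurve := hγs.continuous
  have hDclosed : IsClosed D := by
    refine (((isClosed_Icc.prod isClosed_Icc).inter ?_).inter ?_)
    · exact isClosed_eq (hγc.comp continuous_fst) (hγc.comp continuous_snd)
    · exact isClosed_iInter fun k ↦ isClosed_le continuous_const (by fun_prop)
  have hDc : IsCompact D :=
    (isCompact_Icc.prod isCompact_Icc).of_isClosed_subset hDclosed fun p hp ↦ hp.1.1
  -- far double points are transverse
  have hfar_cp : ∀ p ∈ D, circlePoint p.1 ≠ circlePoint p.2 := by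
    rintro ⟨s, t⟩ ⟨-, hfar⟩ hst
    obtain ⟨k, hk⟩ := exists_eq_add_of_circlePoint_eq hst
    have hk' : s = t + k * (2 * Real.pi) := hk
    have := mem_iInter.1 hfar k
    simp only [mem_setOf_eq] at this
    rw [hk', add_sub_cancel_left, sub_self, abs_zero] at this
    linarith
  -- `D` is finite: an accumulation point would contradict local injectivity
  have hDfin : D.Finite := by
    by_contra hinf
    obtain ⟨p, hpD, hacc⟩ := Set.Infinite.exists_accPt_of_subset_isCompact hinf hDc Subset.rfl
    have hcross : cross (deriv K.planeCurve p.1) (deriv K.planeCurve p.2) ≠ 0 :=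
      (h.transverse p.1 p.2 hpD.1.2).resolve_left (hfar_cp p hpD)
    obtain ⟨U, hU, hinjU⟩ := exists_nhds_injOn_of_cross_ne_zero hγs hcross
    rw [accPt_iff_frequently] at hacc
    obtain ⟨q, ⟨hqp, hqD⟩, hqU⟩ := (hacc.and_eventually hU).exists
    refine hqp (hinjU hqU (mem_of_mem_nhds hU) ?_)
    show K.planeCurve q.1 - K.planeCurve q.2 = K.planeCurve p.1 - K.planeCurve p.2
    rw [sub_eq_zero.2 hqD.1.2, sub_eq_zero.2 hpD.1.2]
  -- the crossing set is the first projection of `D`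
  refine (hDfin.image Prod.fst).subset ?_
  rintro s ⟨hs, t, hts, hγst⟩
  obtain ⟨t', ht', hcp, -⟩ := exists_mem_Ico_circlePoint_eq t
  have hγt : K.planeCurve t' = K.planeCurve t :=
    Periodic.eq_of_circlePoint_eq K.periodic_planeCurve hcp
  refine ⟨(s, t'), ⟨⟨⟨Ico_subset_Icc_self hs, Ico_subset_Icc_self ht'⟩, ?_⟩, ?_⟩, rfl⟩
  · show K.planeCurve s = K.planeCurve t'
    rw [hγt]; exact hγst
  · refine mem_iInter.2 fun k ↦ ?_
    show δ ≤ |s - t' - k * (2 * Real.pi)|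
    by_contra hlt
    push Not at hlt
    have heq : s = t' + k * (2 * Real.pi) := by
      refine hnear s (t' + k * (2 * Real.pi)) ?_ ?_
      · rw [show s - (t' + k * (2 * Real.pi)) = s - t' - k * (2 * Real.pi) by ring]; exact hlt.le
      · rw [(K.periodic_planeCurve.int_mul k) t', hγt]; exact hγst
    apply hts
    rw [← hcp, heq]
    exact ((periodic_circlePoint.int_mul k) t').symm

omit h in
/-- A crossing parameter has a **partner** in the crossing set. [folklore] -/
theorem exists_partner {s : ℝ} (hs : s ∈ crossingSet K) :
    ∃ t ∈ crossingSet K, circlePoint t ≠ circlePoint s ∧ K.planeCurve s = K.planeCurve t := by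
  obtain ⟨hsI, t, hts, hγ⟩ := hs
  obtain ⟨t', ht', hcp, -⟩ := exists_mem_Ico_circlePoint_eq t
  have hγt : K.planeCurve t' = K.planeCurve t :=
    Periodic.eq_of_circlePoint_eq K.periodic_planeCurve hcp
  refine ⟨t', ⟨ht', s, ?_, ?_⟩, ?_, ?_⟩
  · rw [hcp]; exact hts.symm
  · rw [hγt, hγ]
  · rw [hcp]; exact hts
  · rw [hγt, hγ]

/-- The partner is unique (no triple points). [folklore] -/
theorem partner_unique {s t₁ t₂ : ℝ} (ht₁ : t₁ ∈ crossingSet K) (ht₂ : t₂ ∈ crossingSet K)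
    (h₁ : circlePoint t₁ ≠ circlePoint s) (h₂ : circlePoint t₂ ≠ circlePoint s)
    (hγ₁ : K.planeCurve s = K.planeCurve t₁) (hγ₂ : K.planeCurve s = K.planeCurve t₂) :
    t₁ = t₂ := by
  have := h.no_triple t₁ t₂ s hγ₁.symm hγ₂.symm
  rcases this with h12 | h2s | h1s
  · exact eq_of_circlePoint_eq_of_mem_Ico ht₁.1 ht₂.1 h12
  · exact absurd h2s h₂
  · exact absurd h1s h₁

/-- **The partner map** of the crossing set (the other end of the chord through `s`); the
identity off the crossing set. [folklore] -/
def partner (_h : K.InGeneralPosition) (s : ℝ) : ℝ :=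
  open Classical in
  if hs : s ∈ crossingSet K then Classical.choose (exists_partner hs) else s

/-- The defining properties of the partner. [folklore] -/
theorem partner_spec {s : ℝ} (hs : s ∈ crossingSet K) :
    h.partner s ∈ crossingSet K ∧ circlePoint (h.partner s) ≠ circlePoint s ∧
      K.planeCurve s = K.planeCurve (h.partner s) := by
  rw [partner, dif_pos hs]
  obtain ⟨h1, h2, h3⟩ := Classical.choose_spec (exists_partner hs)
  exact ⟨h1, h2, h3⟩

/-- The partner lies in the crossing set. [folklore] -/
theorem partner_mem {s : ℝ} (hs : s ∈ crossingSet K) : h.partner s ∈ crossingSet K :=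
  (h.partner_spec hs).1

/-- The partner is another point of the circle. [folklore] -/
theorem circlePoint_partner_ne {s : ℝ} (hs : s ∈ crossingSet K) :
    circlePoint (h.partner s) ≠ circlePoint s :=
  (h.partner_spec hs).2.1

/-- The partner differs from `s`. [folklore] -/
theorem partner_ne {s : ℝ} (hs : s ∈ crossingSet K) : h.partner s ≠ s := fun he ↦
  h.circlePoint_partner_ne hs (by rw [he])

/-- The partner has the same projection. [folklore] -/
theorem planeCurve_partner {s : ℝ} (hs : s ∈ crossingSet K) :
    K.planeCurve (h.partner s) = K.planeCurve s :=
  (h.partner_spec hs).2.2.symm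

/-- Characterisation of the partner by its properties. [folklore] -/
theorem partner_eq {s t : ℝ} (hs : s ∈ crossingSet K) (ht : t ∈ crossingSet K)
    (hts : circlePoint t ≠ circlePoint s) (hγ : K.planeCurve s = K.planeCurve t) :
    h.partner s = t :=
  h.partner_unique (h.partner_mem hs) ht (h.circlePoint_partner_ne hs) hts
    (h.planeCurve_partner hs).symm hγ

/-- **The partner map is an involution** of the crossing set. [folklore] -/
theorem partner_partner {s : ℝ} (hs : s ∈ crossingSet K) : h.partner (h.partner s) = s :=
  h.partner_eq (h.partner_mem hs) hs (h.circlePoint_partner_ne hs).symm (h.planeCurve_partner hs)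

/-- The partner map is injective on the crossing set. [folklore] -/
theorem partner_injOn : InjOn h.partner (crossingSet K) := fun s hs t ht hst ↦ by
  rw [← h.partner_partner hs, ← h.partner_partner ht, hst]

/-- **The two ends of a chord have different heights** (the knot is injective). [folklore] -/
theorem heightCurve_partner_ne {s : ℝ} (hs : s ∈ crossingSet K) :
    K.heightCurve (h.partner s) ≠ K.heightCurve s := fun he ↦
  h.circlePoint_partner_ne hs
    (h.circlePoint_eq_of_planeCurve_eq_of_heightCurve_eq (h.planeCurve_partner hs) he)

/-! ### The enumerations -/

/-- The crossing set as a finset. [folklore] -/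
def crossings (h : K.InGeneralPosition) : Finset ℝ :=
  h.finite_crossingSet.toFinset

/-- Membership in `crossings`. [folklore] -/
@[simp] theorem mem_crossings {s : ℝ} : s ∈ h.crossings ↔ s ∈ crossingSet K := by
  simp [crossings]

/-- The **over-ends**: crossing parameters higher than their partner. [folklore] -/
def overEnds (h : K.InGeneralPosition) : Finset ℝ :=
  h.crossings.filter fun s ↦ K.heightCurve (h.partner s) < K.heightCurve s

/-- The **under-ends**: crossing parameters lower than their partner. [folklore] -/
def underEnds (h : K.InGeneralPosition) : Finset ℝ :=
  h.crossings.filter fun s ↦ ¬ K.heightCurve (h.partner s) < K.heightCurve s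

/-- Membership in `overEnds`. [folklore] -/
theorem mem_overEnds {s : ℝ} :
    s ∈ h.overEnds ↔ s ∈ crossingSet K ∧ K.heightCurve (h.partner s) < K.heightCurve s := by
  simp [overEnds]

/-- Membership in `underEnds`. [folklore] -/
theorem mem_underEnds {s : ℝ} :
    s ∈ h.underEnds ↔ s ∈ crossingSet K ∧ K.heightCurve s < K.heightCurve (h.partner s) := by
  simp only [underEnds, Finset.mem_filter, mem_crossings, not_lt, and_congr_right_iff]
  intro hs
  exact ⟨fun hle ↦ lt_of_le_of_ne hle (h.heightCurve_partner_ne hs).symm, le_of_lt⟩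

/-- The partner of an over-end is an under-end. [folklore] -/
theorem partner_mem_underEnds {s : ℝ} (hs : s ∈ h.overEnds) : h.partner s ∈ h.underEnds := by
  rw [mem_overEnds] at hs
  rw [mem_underEnds, h.partner_partner hs.1]
  exact ⟨h.partner_mem hs.1, hs.2⟩

/-- The partner of an under-end is an over-end. [folklore] -/
theorem partner_mem_overEnds {s : ℝ} (hs : s ∈ h.underEnds) : h.partner s ∈ h.overEnds := by
  rw [mem_underEnds] at hs
  rw [mem_overEnds, h.partner_partner hs.1]
  exact ⟨h.partner_mem hs.1, hs.2⟩

/-- Over-ends are not under-ends. [folklore] -/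
theorem not_mem_underEnds_of_mem_overEnds {s : ℝ} (hs : s ∈ h.overEnds) : s ∉ h.underEnds := by
  rw [mem_overEnds] at hs
  rw [mem_underEnds, not_and]
  exact fun _ hlt ↦ lt_asymm hlt hs.2

/-- There are as many under-ends as over-ends (the partner map is a bijection between them).
[folklore] -/
theorem card_underEnds : h.underEnds.card = h.overEnds.card := by
  symm
  refine Finset.card_nbij' h.partner h.partner (fun s hs ↦ h.partner_mem_underEnds hs)
    (fun s hs ↦ h.partner_mem_overEnds hs) (fun s hs ↦ ?_) (fun s hs ↦ ?_)
  · exact h.partner_partner ((h.mem_overEnds).1 hs).1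
  · exact h.partner_partner ((h.mem_underEnds).1 hs).1

/-- The **number of crossings** of the projection. [folklore] -/
def numCrossings (h : K.InGeneralPosition) : ℕ :=
  h.overEnds.card

/-- **The crossing set has `2n` elements.** [folklore] -/
theorem card_crossings : h.crossings.card = 2 * h.numCrossings := by
  have := Finset.card_filter_add_card_filter_not
    (s := h.crossings) (p := fun s ↦ K.heightCurve (h.partner s) < K.heightCurve s)
  rw [numCrossings, two_mul]
  rw [← this]
  show h.overEnds.card + h.underEnds.card = _
  rw [h.card_underEnds]

/-- The increasing enumeration of the crossing parameters: position `p ↦ θ p`. [folklore] -/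
def theta (h : K.InGeneralPosition) : Fin (2 * h.numCrossings) → ℝ :=
  h.crossings.orderEmbOfFin h.card_crossings

/-- The position of a crossing parameter. [folklore] -/
def pos (h : K.InGeneralPosition) (x : {x // x ∈ h.crossings}) : Fin (2 * h.numCrossings) :=
  (h.crossings.orderIsoOfFin h.card_crossings).symm x

/-- `θ (pos x) = x`. [folklore] -/
@[simp] theorem theta_pos (x : {x // x ∈ h.crossings}) : h.theta (h.pos x) = x := by
  rw [theta, pos, ← Finset.coe_orderIsoOfFin_apply, OrderIso.apply_symm_apply]

/-- `pos` is injective. [folklore] -/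
theorem pos_injective : Injective h.pos :=
  (h.crossings.orderIsoOfFin h.card_crossings).symm.injective

/-- The enumeration is strictly increasing. [folklore] -/
theorem strictMono_theta : StrictMono h.theta :=
  (h.crossings.orderEmbOfFin h.card_crossings).strictMono

/-- The enumerated parameters lie in the period window. [folklore] -/
theorem theta_mem (p : Fin (2 * h.numCrossings)) : h.theta p ∈ Ico 0 (2 * Real.pi) := by
  have : h.theta p ∈ h.crossings := Finset.orderEmbOfFin_mem _ _ p
  rw [mem_crossings] at this
  exact this.1

/-- The enumeration of the chords by their over-ends. [folklore] -/
def overEnd (h : K.InGeneralPosition) (i : Fin h.numCrossings) : ℝ :=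
  (h.overEnds.orderIsoOfFin rfl i : ℝ)

/-- The over-end of chord `i` is an over-end. [folklore] -/
theorem overEnd_mem (i : Fin h.numCrossings) : h.overEnd i ∈ h.overEnds :=
  (h.overEnds.orderIsoOfFin rfl i).2

/-- The over-end of chord `i` is a crossing parameter. [folklore] -/
theorem overEnd_mem_crossingSet (i : Fin h.numCrossings) : h.overEnd i ∈ crossingSet K :=
  ((h.mem_overEnds).1 (h.overEnd_mem i)).1

/-- `overEnd` is injective. [folklore] -/
theorem overEnd_injective : Injective h.overEnd := fun _ _ hij ↦
  (h.overEnds.orderIsoOfFin rfl).injective (Subtype.ext hij)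

/-- Every over-end is the over-end of some chord. [folklore] -/
theorem exists_overEnd_eq {s : ℝ} (hs : s ∈ h.overEnds) : ∃ i, h.overEnd i = s :=
  ⟨(h.overEnds.orderIsoOfFin rfl).symm ⟨s, hs⟩, by simp [overEnd]⟩

/-- The position of the over-passage of chord `i`. [folklore] -/
def overPosition (h : K.InGeneralPosition) (i : Fin h.numCrossings) : Fin (2 * h.numCrossings) :=
  h.pos ⟨h.overEnd i, (h.mem_crossings).2 (h.overEnd_mem_crossingSet i)⟩

/-- The position of the under-passage of chord `i`. [folklore] -/
def underPosition (h : K.InGeneralPosition) (i : Fin h.numCrossings) :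
    Fin (2 * h.numCrossings) :=
  h.pos ⟨h.partner (h.overEnd i), (h.mem_crossings).2 (h.partner_mem (h.overEnd_mem_crossingSet i))⟩

/-- The parameter of the over-passage of chord `i`. [folklore] -/
@[simp] theorem theta_overPosition (i : Fin h.numCrossings) :
    h.theta (h.overPosition i) = h.overEnd i := by
  rw [overPosition, theta_pos]

/-- The parameter of the under-passage of chord `i`. [folklore] -/
@[simp] theorem theta_underPosition (i : Fin h.numCrossings) :
    h.theta (h.underPosition i) = h.partner (h.overEnd i) := by
  rw [underPosition, theta_pos]

/-- **The chord ends are jointly a bijection onto the positions.** [folklore] -/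
theorem bijective_positions : Bijective (Sum.elim h.overPosition h.underPosition) := by
  classical
  refine (Fintype.bijective_iff_injective_and_card _).2 ⟨?_, by simp; omega⟩
  have hOU : ∀ i j, h.overEnd i ≠ h.partner (h.overEnd j) := by
    intro i j he
    exact h.not_mem_underEnds_of_mem_overEnds (h.overEnd_mem i)
      (he ▸ h.partner_mem_underEnds (h.overEnd_mem j))
  have hval : ∀ {x y : {x // x ∈ h.crossings}}, h.pos x = h.pos y → (x : ℝ) = y :=
    fun hxy ↦ congrArg Subtype.val (h.pos_injective hxy)
  rintro (i | i) (j | j) hij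
  · simp only [Sum.elim_inl, overPosition] at hij
    rw [h.overEnd_injective (hval hij)]
  · simp only [Sum.elim_inl, Sum.elim_inr, overPosition, underPosition] at hij
    exact absurd (hval hij) (hOU i j)
  · simp only [Sum.elim_inl, Sum.elim_inr, overPosition, underPosition] at hij
    exact absurd (hval hij).symm (hOU j i)
  · simp only [Sum.elim_inr, underPosition] at hij
    rw [h.overEnd_injective (h.partner_injOn (h.overEnd_mem_crossingSet i)
      (h.overEnd_mem_crossingSet j) (hval hij))]

/-- The **sign** of chord `i`: the sign of `det (γ' over, γ' under)`. [folklore] -/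
def chordSign (h : K.InGeneralPosition) (i : Fin h.numCrossings) : ℤˣ :=
  if 0 < cross (deriv K.planeCurve (h.overEnd i)) (deriv K.planeCurve (h.partner (h.overEnd i)))
  then 1 else -1

/-- **The Gauss diagram read off a knot in general position.** GPV (2000), §1.2; Cromwell
(2004), Def. 3.3.1. [cite: GPV2000, §1.2] -/
def gaussDiagram (h : K.InGeneralPosition) : GaussDiagram where
  n := h.numCrossings
  overPos := h.overPosition
  underPos := h.underPosition
  sign := h.chordSign
  bijective := h.bijective_positions

/-- The crossing of chord `i` is transverse. [folklore] -/
theorem cross_overEnd_ne_zero (i : Fin h.numCrossings) :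
    cross (deriv K.planeCurve (h.overEnd i)) (deriv K.planeCurve (h.partner (h.overEnd i))) ≠ 0 := by
  have hs := h.overEnd_mem_crossingSet i
  refine (h.transverse _ _ (h.planeCurve_partner hs).symm).resolve_left fun he ↦ ?_
  exact h.circlePoint_partner_ne hs he.symm

/-- **The multiple points of the plane curve are the listed crossings.** [folklore] -/
theorem eq_or_crossing (s t : ℝ) (hst : K.planeCurve s = K.planeCurve t) :
    (∃ k : ℤ, t = s + k * (2 * Real.pi)) ∨
      ∃ (i : Fin h.numCrossings) (k l : ℤ),
        ({s + k * (2 * Real.pi), t + l * (2 * Real.pi)} : Set ℝ) =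
          {h.theta (h.overPosition i), h.theta (h.underPosition i)} := by
  by_cases hcp : circlePoint s = circlePoint t
  · obtain ⟨k, hk⟩ := exists_eq_add_of_circlePoint_eq hcp
    exact Or.inl ⟨-k, by rw [hk]; push_cast; ring⟩
  right
  obtain ⟨s', hs', hcps, a, ha⟩ := exists_mem_Ico_circlePoint_eq s
  obtain ⟨t', ht', hcpt, b, hb⟩ := exists_mem_Ico_circlePoint_eq t
  have hγs : K.planeCurve s' = K.planeCurve s :=
    Periodic.eq_of_circlePoint_eq K.periodic_planeCurve hcps
  have hγt : K.planeCurve t' = K.planeCurve t :=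
    Periodic.eq_of_circlePoint_eq K.periodic_planeCurve hcpt
  have hne : circlePoint t' ≠ circlePoint s' := by rw [hcps, hcpt]; exact Ne.symm hcp
  have hsT : s' ∈ crossingSet K := ⟨hs', t', hne, by rw [hγs, hγt, hst]⟩
  have htT : t' ∈ crossingSet K := ⟨ht', s', hne.symm, by rw [hγs, hγt, hst]⟩
  have hpartner : h.partner s' = t' := h.partner_eq hsT htT hne (by rw [hγs, hγt, hst])
  by_cases hover : K.heightCurve (h.partner s') < K.heightCurve s'
  · -- `s'` is the over-end of its chord
    obtain ⟨i, hi⟩ := h.exists_overEnd_eq ((h.mem_overEnds).2 ⟨hsT, hover⟩)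
    refine ⟨i, a, b, ?_⟩
    rw [theta_overPosition, theta_underPosition, hi, hpartner, ← ha, ← hb]
  · -- `t'` is the over-end of its chord
    have hsU : s' ∈ h.underEnds := by
      rw [mem_underEnds]
      exact ⟨hsT, lt_of_le_of_ne (not_lt.1 hover) (h.heightCurve_partner_ne hsT).symm⟩
    have htO : t' ∈ h.overEnds := hpartner ▸ h.partner_mem_overEnds hsU
    obtain ⟨i, hi⟩ := h.exists_overEnd_eq htO
    refine ⟨i, a, b, ?_⟩
    rw [theta_overPosition, theta_underPosition, hi, ← hpartner, h.partner_partner hsT, hpartner,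
      ← ha, ← hb, Set.pair_comm]

/-- **The regular projection of a knot in general position.** Cromwell (2004), §3.2–3.3.
[cite: Cromwell2004, Thm. 3.2.1] -/
def regularProjection (h : K.InGeneralPosition) : K.RegularProjection where
  diagram := h.gaussDiagram
  θ := h.theta
  strictMono := h.strictMono_theta
  lt_add_two_pi i j := by
    have hi := h.theta_mem i
    have hj := h.theta_mem j
    linarith [hi.2, hj.1]
  northPole_notMem := by
    rintro ⟨x, hx⟩
    exact h.ne_northPole x hx
  deriv_ne_zero := h.deriv_ne_zero
  double i := by
    show K.planeCurve (h.theta (h.overPosition i)) = K.planeCurve (h.theta (h.underPosition i))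
    rw [theta_overPosition, theta_underPosition, h.planeCurve_partner (h.overEnd_mem_crossingSet i)]
  eq_or_crossing := h.eq_or_crossing
  heightCurve_lt i := by
    show K.heightCurve (h.theta (h.underPosition i)) < K.heightCurve (h.theta (h.overPosition i))
    rw [theta_overPosition, theta_underPosition]
    exact ((h.mem_overEnds).1 (h.overEnd_mem i)).2
  sign_eq i := by
    show ((h.chordSign i : ℤˣ) : ℤ) = SignType.sign (Matrix.det
      !![(deriv K.planeCurve (h.theta (h.overPosition i))).1,
          (deriv K.planeCurve (h.theta (h.overPosition i))).2;
         (deriv K.planeCurve (h.theta (h.underPosition i))).1,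
          (deriv K.planeCurve (h.theta (h.underPosition i))).2])
    rw [theta_overPosition, theta_underPosition, ← cross_eq_det, chordSign]
    rcases lt_trichotomy (cross (deriv K.planeCurve (h.overEnd i))
      (deriv K.planeCurve (h.partner (h.overEnd i)))) 0 with hlt | heq | hgt
    · rw [if_neg (not_lt.2 hlt.le), sign_neg hlt]; simp
    · exact absurd heq (h.cross_overEnd_ne_zero i)
    · rw [if_pos hgt, sign_pos hgt]; simp

/-- **A knot in general position has a Gauss diagram.** Reidemeister (1932), Kap. I §1;
Cromwell (2004), Thm. 3.2.1 and Def. 3.3.1. [cite: Reidemeister1932, Kap. I §1] -/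
theorem hasGaussDiagram : K.HasGaussDiagram h.gaussDiagram :=
  ⟨h.regularProjection, rfl⟩

end InGeneralPosition

end Knot

end Literature.Topology.FourManifolds
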